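import Mathlib

/-!
# Stub `stub_rowVorticityConstruction` (crux stmt-AnomalousDissipation-3009, line
# braid-closed-large-circulation-gluing) — tools I: the kernels of the cylinder Biot–Savart law

Helper file (supports stmt-AnomalousDissipation-3009; first brick of the CYLINDER BIOT–SAVART LAW by which
`stub_rowVorticityConstruction` reconstructs the velocity `(u, v)` of an `L`-periodic vorticity `ω`).
On the cylinder `(ℝ/Lℤ) × ℝ` the Green's function of the Laplacian is `(4π)⁻¹ Φ(2πx/L, 2πy/L)` with the
NORMALISED LOGARITHMIC KERNEL `Φ(s, t) = log (cosh t − cos s)` (`= log |2 sin((s + it)/2)|²`), whose gradient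
`(∂ₛΦ, ∂ₜΦ) = (sin s, sinh t)/(cosh t − cos s) =: (k₂, k₁)` is the real form of `cot((s + it)/2)`:
`u − iv = (2Li)⁻¹ ∫∫ ω(ζ') cot(π(z − ζ')/L)` (Lamb, *Hydrodynamics*, §156; Saffman, *Vortex Dynamics*, §7.2),
i.e. `u = −(2L)⁻¹ ∫∫ k₁ ω`, `v = (2L)⁻¹ ∫∫ k₂ ω`; for `ω = −L δ₀` periodised this is the row field
`(½ sinh t, −½ sin s)/(cosh t − cos s)` frozen in `stub_braidExit`.

Registered sub-goal proved here: `stub_rowVorticityConstruction_kernelBounds` (the three local bounds below).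

This file is the elementary real analysis of the denominator `D(s, t) = cosh t − cos s` and of `k₁, k₂, Φ`
on the centred period strip `|s| ≤ π` (all statements pointwise, all proofs from Mathlib; `[folklore]`):

* `D ≥ 0`; `D ≥ ‖(s,t)‖²/5` for `|s| ≤ π` (sup norm of `ℝ × ℝ`), so `D = 0` on the strip only at the origin;
  `D ≥ (5/14) e^{|t|}` for `|t| ≥ 2`; `D ≤ 2 e^{|t|}`;
* the LOCAL-INTEGRABILITY BOUNDS `|k₁|, |k₂| ≤ 2 + 20/‖(s,t)‖` and `|Φ| ≤ 10 + 3|t| + 2/‖(s,t)‖` on `|s| ≤ π`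
  (a `1/r` singularity in the plane: the kernels are `L¹_loc`, which is all the differentiation-under-the-
  integral lemmas of the next files use);
* the FAR-FIELD BOUNDS `|k₂| ≤ 3e^{−|t|}`, `|k₁ − 1| ≤ 6e^{−t}` (`t ≥ 2`), `|k₁ + 1| ≤ 6e^{t}` (`t ≤ −2`)
  (source of `u → ∓(2L)⁻¹∫∫ω`, `v → 0` and of the `e^{−2π|y|/L}` decay of velocity gradients);
* symmetries: `D`, `Φ` even, `k₁, k₂` odd under `(s,t) ↦ (−s,−t)`; `2π`-periodicity in `s`;
* calculus off the zero set of `D`: `∂ₜΦ = k₁`, `∂ₛΦ = k₂` (`HasDerivAt`), continuity/measurability.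
-/

set_option linter.dupNamespace false

noncomputable section

open Real Set Filter Topology

namespace Summit.AnomalousDissipation.AnomalousDissipation.Theorems.MarginalStabilityChainStretchedVortexRows.RowBiotSavart

/-! ### Hyperbolic and trigonometric inequalities -/

/-- `|sinh t| ≤ 4|t|` for `|t| ≤ 2` (`cosh 2 ≤ 4`). [folklore] -/
theorem abs_sinh_le_four_mul {t : ℝ} (ht : |t| ≤ 2) : |Real.sinh t| ≤ 4 * |t| := by
  rw [Real.abs_sinh]
  -- `sinh r ≤ r cosh r` for `r ≥ 0`: termwise comparison of the power series
  have h1 : Real.sinh |t| ≤ |t| * Real.cosh |t| := by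
    refine hasSum_le (fun n => ?_) (Real.hasSum_sinh |t|) ((Real.hasSum_cosh |t|).mul_left |t|)
    have hf : ((2 * n).factorial : ℝ) ≤ ((2 * n + 1).factorial : ℝ) := by
      exact_mod_cast Nat.factorial_le (Nat.le_succ _)
    have hfpos : (0 : ℝ) < ((2 * n).factorial : ℝ) := by exact_mod_cast Nat.factorial_pos _
    rw [pow_succ, mul_comm (|t| ^ (2 * n)) |t|, mul_div_assoc]
    exact mul_le_mul_of_nonneg_left (div_le_div_of_nonneg_left (by positivity) hfpos hf) (abs_nonneg t)
  have h2 : Real.cosh |t| ≤ Real.cosh 2 := by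
    rw [Real.cosh_le_cosh, abs_abs, abs_of_pos (by norm_num : (0:ℝ) < 2)]; exact ht
  have h3 : Real.cosh 2 ≤ 4 := by
    rw [Real.cosh_eq]
    have he : Real.exp 2 ≤ 2.7182818286 ^ 2 := by
      rw [show (2:ℝ) = 1 + 1 by norm_num, Real.exp_add, sq]
      exact mul_le_mul Real.exp_one_lt_d9.le Real.exp_one_lt_d9.le (Real.exp_pos _).le (by norm_num)
    have h7 : (7:ℝ) ≤ Real.exp 2 := by
      rw [show (2:ℝ) = 1 + 1 by norm_num, Real.exp_add]
      nlinarith [Real.exp_one_gt_d9]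
    have he' : Real.exp (-2) ≤ 1 / 7 := by
      rw [Real.exp_neg, one_div]
      exact inv_anti₀ (by norm_num) h7
    norm_num at he ⊢; linarith
  calc Real.sinh |t| ≤ |t| * Real.cosh |t| := h1
    _ ≤ |t| * 4 := mul_le_mul_of_nonneg_left (h2.trans h3) (abs_nonneg t)
    _ = 4 * |t| := by ring

/-- `2s²/π² ≤ 1 − cos s` for `|s| ≤ π` (`1 − cos s = 2 sin²(s/2)` and Jordan's inequality). [folklore] -/
theorem sq_le_one_sub_cos {s : ℝ} (hs : |s| ≤ π) : 2 / π ^ 2 * s ^ 2 ≤ 1 - Real.cos s := by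
  have key : ∀ r : ℝ, 0 ≤ r → r ≤ π → 2 / π ^ 2 * r ^ 2 ≤ 1 - Real.cos r := by
    intro r hr0 hrπ
    have hc : Real.cos r = 1 - 2 * Real.sin (r / 2) ^ 2 := by
      have := Real.cos_two_mul (r / 2)
      rw [show 2 * (r / 2) = r by ring] at this
      nlinarith [Real.sin_sq_add_cos_sq (r / 2)]
    have hj : 2 / π * (r / 2) ≤ Real.sin (r / 2) := Real.mul_le_sin (by linarith) (by linarith)
    have hj0 : 0 ≤ 2 / π * (r / 2) := by positivity
    have hsq : (2 / π * (r / 2)) ^ 2 ≤ Real.sin (r / 2) ^ 2 := pow_le_pow_left₀ hj0 hj 2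
    rw [hc]
    have : (2 / π * (r / 2)) ^ 2 = r ^ 2 / π ^ 2 := by field_simp
    rw [this] at hsq
    have hππ : (0:ℝ) < π ^ 2 := by positivity
    calc 2 / π ^ 2 * r ^ 2 = 2 * (r ^ 2 / π ^ 2) := by ring
      _ ≤ 2 * Real.sin (r / 2) ^ 2 := by linarith
      _ = 1 - (1 - 2 * Real.sin (r / 2) ^ 2) := by ring
  rcases le_or_gt 0 s with h0 | h0
  · exact key s h0 ((le_abs_self s).trans hs)
  · have := key (-s) (by linarith) ((neg_le_abs s).trans hs)
    simpa [Real.cos_neg] using this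

/-! ### The denominator `D(s, t) = cosh t − cos s` -/

/-- `0 ≤ cosh t − cos s`. [folklore] -/
theorem den_nonneg (s t : ℝ) : 0 ≤ Real.cosh t - Real.cos s := by
  linarith [Real.one_le_cosh t, Real.cos_le_one s]

/-- On the period strip `|s| ≤ π`: `‖(s,t)‖²/5 ≤ cosh t − cos s` (sup norm; `π² ≤ 10`). [folklore] -/
theorem norm_sq_le_den {s : ℝ} (hs : |s| ≤ π) (t : ℝ) :
    ‖((s, t) : ℝ × ℝ)‖ ^ 2 / 5 ≤ Real.cosh t - Real.cos s := by
  -- `t²/2 ≤ cosh t − 1`: two terms of the even power series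
  have h1 : t ^ 2 / 2 ≤ Real.cosh t - 1 := by
    have h := sum_le_hasSum (Finset.range 2)
      (fun n _ => div_nonneg (by rw [pow_mul]; positivity) (by positivity)) (Real.hasSum_cosh t)
    simp only [Finset.sum_range_succ, Finset.sum_range_zero, Nat.factorial, mul_zero, pow_zero,
      Nat.cast_one, div_one, zero_add, mul_one] at h
    norm_num at h
    linarith
  have h2 := sq_le_one_sub_cos hs
  have hπ : π ^ 2 ≤ 10 := by nlinarith [Real.pi_lt_d2, Real.pi_pos]
  have hπ0 : (0:ℝ) < π ^ 2 := by positivity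
  have h3 : s ^ 2 / 5 ≤ 2 / π ^ 2 * s ^ 2 := by
    rw [div_le_iff₀ (by norm_num : (0:ℝ) < 5), mul_comm, ← mul_assoc]
    have : s ^ 2 * 1 ≤ s ^ 2 * (5 * (2 / π ^ 2)) := by
      apply mul_le_mul_of_nonneg_left _ (sq_nonneg s)
      rw [mul_div_assoc', le_div_iff₀ hπ0]; linarith
    linarith
  have hc := Real.cos_le_one s
  have hch := Real.one_le_cosh t
  rw [Prod.norm_def, Real.norm_eq_abs, Real.norm_eq_abs]
  rcases le_total |s| |t| with hst | hst
  · rw [max_eq_right hst, sq_abs]; nlinarith [sq_nonneg s, sq_nonneg t]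
  · rw [max_eq_left hst, sq_abs]; nlinarith [sq_nonneg t, sq_nonneg s]

/-- On the period strip the denominator vanishes only at the origin. [folklore] -/
theorem den_pos {z : ℝ × ℝ} (hs : |z.1| ≤ π) (hz : z ≠ 0) : 0 < Real.cosh z.2 - Real.cos z.1 := by
  have h := norm_sq_le_den hs z.2
  have hn : 0 < ‖z‖ := norm_pos_iff.2 hz
  have : 0 < ‖((z.1, z.2) : ℝ × ℝ)‖ ^ 2 / 5 := by simp only [Prod.mk.eta]; positivity
  simp only [Prod.mk.eta] at h
  linarith

/-- `cosh t − cos s ≤ 2 e^{|t|}`. [folklore] -/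
theorem den_le_two_mul_exp (s t : ℝ) : Real.cosh t - Real.cos s ≤ 2 * Real.exp |t| := by
  have h1 : Real.cosh t ≤ Real.exp |t| := by
    rw [← Real.cosh_abs, Real.cosh_eq]
    have : Real.exp (-|t|) ≤ Real.exp |t| := Real.exp_le_exp.2 (by linarith [abs_nonneg t])
    linarith
  have h2 : -Real.cos s ≤ 1 := by linarith [Real.neg_one_le_cos s]
  have h3 : 1 ≤ Real.exp |t| := Real.one_le_exp (abs_nonneg t)
  linarith

/-- `7 ≤ e^{|t|}` for `|t| ≥ 2`. [folklore] -/
theorem seven_le_exp {t : ℝ} (ht : 2 ≤ |t|) : 7 ≤ Real.exp |t| := by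
  have h2 : Real.exp 2 ≤ Real.exp |t| := Real.exp_le_exp.2 ht
  have h7 : (7:ℝ) ≤ Real.exp 2 := by
    rw [show (2:ℝ) = 1 + 1 by norm_num, Real.exp_add]
    nlinarith [Real.exp_one_gt_d9]
  linarith

/-- Far from the axis the denominator is exponentially large: `(5/14) e^{|t|} ≤ cosh t − cos s` for
`|t| ≥ 2` (`e² > 7`). [folklore] -/
theorem exp_le_den {t : ℝ} (ht : 2 ≤ |t|) (s : ℝ) :
    5 / 14 * Real.exp |t| ≤ Real.cosh t - Real.cos s := by
  have he : 7 ≤ Real.exp |t| := seven_le_exp ht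
  have hc : Real.exp |t| / 2 - 1 ≤ Real.cosh t - 1 := by
    rw [← Real.cosh_abs, Real.cosh_eq]; linarith [Real.exp_pos (-|t|)]
  have hcos : Real.cos s ≤ 1 := Real.cos_le_one s
  linarith

/-! ### The velocity kernels `k₁ = sinh t / D`, `k₂ = sin s / D` -/

/-- LOCAL BOUND for `k₁`: `|sinh t / (cosh t − cos s)| ≤ 2 + 20/‖(s,t)‖` on `|s| ≤ π` (at the origin both
sides are read with Lean's `x/0 = 0`). [folklore] -/
theorem abs_kerU_le {z : ℝ × ℝ} (hs : |z.1| ≤ π) :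
    |Real.sinh z.2 / (Real.cosh z.2 - Real.cos z.1)| ≤ 2 + 20 / ‖z‖ := by
  by_cases hz : z = 0
  · subst hz; simp
  have hD := den_pos hs hz
  have hn : 0 < ‖z‖ := norm_pos_iff.2 hz
  rw [abs_div, abs_of_pos hD, div_le_iff₀ hD]
  rcases le_or_gt 2 |z.2| with ht | ht
  · -- far: |sinh t| ≤ e^{|t|}/2 ≤ (7/5)·(5/14)e^{|t|} ≤ 2 D
    have h1 : |Real.sinh z.2| ≤ Real.exp |z.2| / 2 := by
      rw [Real.abs_sinh, Real.sinh_eq]; linarith [Real.exp_pos (-|z.2|)]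
    have h2 := exp_le_den ht z.1
    have h3 : 0 ≤ 20 / ‖z‖ * (Real.cosh z.2 - Real.cos z.1) := by positivity
    nlinarith
  · -- near: |sinh t| ≤ 4|t| ≤ 4‖z‖ and ‖z‖²/5 ≤ D
    have h1 : |Real.sinh z.2| ≤ 4 * |z.2| := abs_sinh_le_four_mul ht.le
    have h2 : |z.2| ≤ ‖z‖ := by rw [Prod.norm_def]; exact le_max_right _ _
    have h3 := norm_sq_le_den hs z.2
    simp only [Prod.mk.eta] at h3
    have h4 : 20 / ‖z‖ * (Real.cosh z.2 - Real.cos z.1) ≥ 20 / ‖z‖ * (‖z‖ ^ 2 / 5) :=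
      mul_le_mul_of_nonneg_left h3 (by positivity)
    have h5 : 20 / ‖z‖ * (‖z‖ ^ 2 / 5) = 4 * ‖z‖ := by field_simp; ring
    nlinarith

/-- LOCAL BOUND for `k₂`: `|sin s / (cosh t − cos s)| ≤ 2 + 20/‖(s,t)‖` on `|s| ≤ π`. [folklore] -/
theorem abs_kerV_le {z : ℝ × ℝ} (hs : |z.1| ≤ π) :
    |Real.sin z.1 / (Real.cosh z.2 - Real.cos z.1)| ≤ 2 + 20 / ‖z‖ := by
  by_cases hz : z = 0
  · subst hz; simp
  have hD := den_pos hs hz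
  have hn : 0 < ‖z‖ := norm_pos_iff.2 hz
  rw [abs_div, abs_of_pos hD, div_le_iff₀ hD]
  rcases le_or_gt 2 |z.2| with ht | ht
  · have h1 : |Real.sin z.1| ≤ 1 := Real.abs_sin_le_one _
    have h2 := exp_le_den ht z.1
    have h7 : (7:ℝ) ≤ Real.exp |z.2| := seven_le_exp ht
    have h3 : 0 ≤ 20 / ‖z‖ * (Real.cosh z.2 - Real.cos z.1) := by positivity
    nlinarith
  · have h1 : |Real.sin z.1| ≤ |z.1| := Real.abs_sin_le_abs
    have h2 : |z.1| ≤ ‖z‖ := by rw [Prod.norm_def]; exact le_max_left _ _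
    have h3 := norm_sq_le_den hs z.2
    simp only [Prod.mk.eta] at h3
    have h4 : 20 / ‖z‖ * (Real.cosh z.2 - Real.cos z.1) ≥ 20 / ‖z‖ * (‖z‖ ^ 2 / 5) :=
      mul_le_mul_of_nonneg_left h3 (by positivity)
    have h5 : 20 / ‖z‖ * (‖z‖ ^ 2 / 5) = 4 * ‖z‖ := by field_simp; ring
    nlinarith

/-- FAR-FIELD BOUND for `k₂`: `|sin s / (cosh t − cos s)| ≤ 3 e^{−|t|}` for `|t| ≥ 2`. [folklore] -/
theorem abs_kerV_le_exp {s t : ℝ} (ht : 2 ≤ |t|) :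
    |Real.sin s / (Real.cosh t - Real.cos s)| ≤ 3 * Real.exp (-|t|) := by
  have h2 := exp_le_den ht s
  have hD : 0 < Real.cosh t - Real.cos s := lt_of_lt_of_le (by positivity) h2
  rw [abs_div, abs_of_pos hD, div_le_iff₀ hD]
  have h1 : |Real.sin s| ≤ 1 := Real.abs_sin_le_one _
  have h3 : Real.exp (-|t|) * Real.exp |t| = 1 := by rw [← Real.exp_add]; simp
  nlinarith [Real.exp_pos (-|t|)]

/-- FAR-FIELD BOUND for `k₁` above the row: `|sinh t/(cosh t − cos s) − 1| ≤ 6 e^{−t}` for `t ≥ 2`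
(`k₁ − 1 = (cos s − e^{−t})/D`). [folklore] -/
theorem abs_kerU_sub_one_le_exp {s t : ℝ} (ht : 2 ≤ t) :
    |Real.sinh t / (Real.cosh t - Real.cos s) - 1| ≤ 6 * Real.exp (-t) := by
  have ht' : 2 ≤ |t| := ht.trans (le_abs_self t)
  have h2 := exp_le_den ht' s
  rw [abs_of_nonneg (by linarith : (0:ℝ) ≤ t)] at h2
  have hD : 0 < Real.cosh t - Real.cos s := lt_of_lt_of_le (by positivity) h2
  have hnum : Real.sinh t / (Real.cosh t - Real.cos s) - 1 =
      (Real.cos s - Real.exp (-t)) / (Real.cosh t - Real.cos s) := by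
    rw [eq_div_iff hD.ne', sub_mul, div_mul_cancel₀ _ hD.ne', Real.sinh_eq, Real.cosh_eq]; ring
  rw [hnum, abs_div, abs_of_pos hD, div_le_iff₀ hD]
  have h1 : |Real.cos s - Real.exp (-t)| ≤ 2 := by
    have := Real.abs_cos_le_one s
    have he : 0 < Real.exp (-t) := Real.exp_pos _
    have he' : Real.exp (-t) ≤ 1 := by rw [Real.exp_le_one_iff]; linarith
    rw [abs_le] at this ⊢; constructor <;> linarith
  have h3 : Real.exp (-t) * Real.exp t = 1 := by rw [← Real.exp_add]; simp
  nlinarith [Real.exp_pos (-t)]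

/-- FAR-FIELD BOUND for `k₁` below the row: `|sinh t/(cosh t − cos s) + 1| ≤ 6 e^{t}` for `t ≤ −2`.
[folklore] -/
theorem abs_kerU_add_one_le_exp {s t : ℝ} (ht : t ≤ -2) :
    |Real.sinh t / (Real.cosh t - Real.cos s) + 1| ≤ 6 * Real.exp t := by
  have h := abs_kerU_sub_one_le_exp (s := s) (t := -t) (by linarith)
  rw [Real.sinh_neg, Real.cosh_neg, neg_neg, neg_div, ← abs_neg] at h
  convert h using 2; ring

/-! ### Symmetries -/

/-- `k₁` is odd under the point reflection `(s,t) ↦ (−s,−t)`. [folklore] -/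
theorem kerU_neg (s t : ℝ) :
    Real.sinh (-t) / (Real.cosh (-t) - Real.cos (-s)) = -(Real.sinh t / (Real.cosh t - Real.cos s)) := by
  rw [Real.sinh_neg, Real.cosh_neg, Real.cos_neg, neg_div]

/-- `k₂` is odd under the point reflection `(s,t) ↦ (−s,−t)`. [folklore] -/
theorem kerV_neg (s t : ℝ) :
    Real.sin (-s) / (Real.cosh (-t) - Real.cos (-s)) = -(Real.sin s / (Real.cosh t - Real.cos s)) := by
  rw [Real.sin_neg, Real.cosh_neg, Real.cos_neg, neg_div]

/-- The logarithmic kernel is even under the point reflection. [folklore] -/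
theorem logKer_neg (s t : ℝ) :
    Real.log (Real.cosh (-t) - Real.cos (-s)) = Real.log (Real.cosh t - Real.cos s) := by
  rw [Real.cosh_neg, Real.cos_neg]

/-- The denominator is `2π`-periodic in `s`. [folklore] -/
theorem den_periodic (t : ℝ) : Function.Periodic (fun s => Real.cosh t - Real.cos s) (2 * π) := by
  intro s; simp [Real.cos_add_two_pi]

/-! ### The logarithmic kernel `Φ = log D` -/

/-- LOCAL BOUND for the logarithmic kernel: `|log (cosh t − cos s)| ≤ 10 + 3|t| + 2/‖(s,t)‖` on the strip
`|s| ≤ π` (log singularity at the origin, linear growth `≈ |t|` at `t → ±∞`). [folklore] -/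
theorem abs_logKer_le {z : ℝ × ℝ} (hs : |z.1| ≤ π) :
    |Real.log (Real.cosh z.2 - Real.cos z.1)| ≤ 10 + 3 * |z.2| + 2 / ‖z‖ := by
  by_cases hz : z = 0
  · subst hz; simp
  have hD := den_pos hs hz
  have hn : 0 < ‖z‖ := norm_pos_iff.2 hz
  have hup : Real.log (Real.cosh z.2 - Real.cos z.1) ≤ 1 + |z.2| := by
    have h1 := den_le_two_mul_exp z.1 z.2
    have h2 : Real.log (Real.cosh z.2 - Real.cos z.1) ≤ Real.log (2 * Real.exp |z.2|) :=
      Real.log_le_log hD h1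
    rw [Real.log_mul (by norm_num) (Real.exp_pos _).ne', Real.log_exp] at h2
    have h3 : Real.log 2 ≤ 1 := by
      have := Real.log_two_lt_d9; linarith
    linarith
  have hlow : 2 * Real.log ‖z‖ - 2 ≤ Real.log (Real.cosh z.2 - Real.cos z.1) := by
    have h1 := norm_sq_le_den hs z.2
    simp only [Prod.mk.eta] at h1
    have h2 : Real.log (‖z‖ ^ 2 / 5) ≤ Real.log (Real.cosh z.2 - Real.cos z.1) :=
      Real.log_le_log (by positivity) h1
    rw [Real.log_div (by positivity) (by norm_num), Real.log_pow] at h2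
    have h3 : Real.log 5 ≤ 2 := by
      have : (5:ℝ) ≤ Real.exp 2 := by
        rw [show (2:ℝ) = 1 + 1 by norm_num, Real.exp_add]; nlinarith [Real.exp_one_gt_d9]
      have := Real.log_le_log (by norm_num) this
      rwa [Real.log_exp] at this
    push_cast at h2
    linarith
  have hlog : |Real.log ‖z‖| ≤ ‖z‖ + ‖z‖⁻¹ := by
    have ha : Real.log ‖z‖ ≤ ‖z‖ - 1 := Real.log_le_sub_one_of_pos hn
    have hb : Real.log ‖z‖⁻¹ ≤ ‖z‖⁻¹ - 1 := Real.log_le_sub_one_of_pos (inv_pos.2 hn)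
    rw [Real.log_inv] at hb
    rw [abs_le]; constructor <;> nlinarith [hn, inv_pos.2 hn]
  have hzle : ‖z‖ ≤ π + |z.2| := by
    rw [Prod.norm_def, Real.norm_eq_abs, Real.norm_eq_abs]
    exact max_le (hs.trans (by linarith [abs_nonneg z.2])) (by linarith [Real.pi_pos])
  have hπ : π ≤ 4 := by linarith [Real.pi_lt_d2]
  have hdiv : 2 / ‖z‖ = 2 * ‖z‖⁻¹ := div_eq_mul_inv _ _
  have hi : 0 < ‖z‖⁻¹ := inv_pos.2 hn
  have ht0 := abs_nonneg z.2
  rw [abs_le] at hlog ⊢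
  rw [hdiv]
  constructor <;> nlinarith [hlog.1, hlog.2]

/-! ### Calculus off the zero set -/

/-- `∂ₜ log (cosh t − cos s) = sinh t / (cosh t − cos s)` where the denominator is positive. [folklore] -/
theorem hasDerivAt_logKer_snd {s t : ℝ} (hD : 0 < Real.cosh t - Real.cos s) :
    HasDerivAt (fun t' => Real.log (Real.cosh t' - Real.cos s))
      (Real.sinh t / (Real.cosh t - Real.cos s)) t := by
  have h1 : HasDerivAt (fun t' => Real.cosh t' - Real.cos s) (Real.sinh t) t := by
    simpa using (Real.hasDerivAt_cosh t).sub_const (Real.cos s)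
  exact h1.log hD.ne'

/-- `∂ₛ log (cosh t − cos s) = sin s / (cosh t − cos s)` where the denominator is positive. [folklore] -/
theorem hasDerivAt_logKer_fst {s t : ℝ} (hD : 0 < Real.cosh t - Real.cos s) :
    HasDerivAt (fun s' => Real.log (Real.cosh t - Real.cos s'))
      (Real.sin s / (Real.cosh t - Real.cos s)) s := by
  have h1 : HasDerivAt (fun s' => Real.cosh t - Real.cos s') (Real.sin s) s := by
    simpa using ((Real.hasDerivAt_cos s).const_sub (Real.cosh t))
  exact h1.log hD.ne'

/-- The denominator is continuous on `ℝ × ℝ`. [folklore] -/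
theorem continuous_den : Continuous fun z : ℝ × ℝ => Real.cosh z.2 - Real.cos z.1 := by
  fun_prop

/-- `k₁` is measurable on `ℝ × ℝ`. [folklore] -/
theorem measurable_kerU : Measurable fun z : ℝ × ℝ => Real.sinh z.2 / (Real.cosh z.2 - Real.cos z.1) := by
  fun_prop

/-- `k₂` is measurable on `ℝ × ℝ`. [folklore] -/
theorem measurable_kerV : Measurable fun z : ℝ × ℝ => Real.sin z.1 / (Real.cosh z.2 - Real.cos z.1) := by
  fun_prop

/-- `Φ` is measurable on `ℝ × ℝ`. [folklore] -/
theorem measurable_logKer : Measurable fun z : ℝ × ℝ => Real.log (Real.cosh z.2 - Real.cos z.1) := by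
  fun_prop

/-- `k₁` is continuous off the zero set of the denominator. [folklore] -/
theorem continuousAt_kerU {z : ℝ × ℝ} (hD : Real.cosh z.2 - Real.cos z.1 ≠ 0) :
    ContinuousAt (fun z : ℝ × ℝ => Real.sinh z.2 / (Real.cosh z.2 - Real.cos z.1)) z := by
  have h1 : ContinuousAt (fun z : ℝ × ℝ => Real.sinh z.2) z := by fun_prop
  exact h1.div continuous_den.continuousAt hD

/-- `k₂` is continuous off the zero set of the denominator. [folklore] -/
theorem continuousAt_kerV {z : ℝ × ℝ} (hD : Real.cosh z.2 - Real.cos z.1 ≠ 0) :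
    ContinuousAt (fun z : ℝ × ℝ => Real.sin z.1 / (Real.cosh z.2 - Real.cos z.1)) z := by
  have h1 : ContinuousAt (fun z : ℝ × ℝ => Real.sin z.1) z := by fun_prop
  exact h1.div continuous_den.continuousAt hD

end RowBiotSavart

/-- **The cylinder kernels are `L¹_loc`-bounded on the period strip** (registered on
stmt-AnomalousDissipation-3009 as the helper stub `stub_rowVorticityConstruction_kernelBounds` of
`stub_rowVorticityConstruction`): for `|s| ≤ π`, `|k₁(s,t)|, |k₂(s,t)| ≤ 2 + 20/‖(s,t)‖` and
`|log(cosh t − cos s)| ≤ 10 + 3|t| + 2/‖(s,t)‖` (`RowBiotSavart.abs_kerU_le`, `abs_kerV_le`, `abs_logKer_le`).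
[folklore] -/
theorem stub_rowVorticityConstruction_kernelBounds :
    ∀ z : ℝ × ℝ, |z.1| ≤ Real.pi →
      |Real.sinh z.2 / (Real.cosh z.2 - Real.cos z.1)| ≤ 2 + 20 / ‖z‖ ∧
      |Real.sin z.1 / (Real.cosh z.2 - Real.cos z.1)| ≤ 2 + 20 / ‖z‖ ∧
      |Real.log (Real.cosh z.2 - Real.cos z.1)| ≤ 10 + 3 * |z.2| + 2 / ‖z‖ :=
  fun _ hz => ⟨RowBiotSavart.abs_kerU_le hz, RowBiotSavart.abs_kerV_le hz, RowBiotSavart.abs_logKer_le hz⟩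

end Summit.AnomalousDissipation.AnomalousDissipation.Theorems.MarginalStabilityChainStretchedVortexRows

end
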